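import Mathlib
import Summits.Ventures.HodgeRepro.CMType
import Summits.Ventures.HodgeRepro.HodgeSets
import Summits.Ventures.HodgeRepro.CMRank
import Summits.Ventures.HodgeRepro.Groups
import Summits.Ventures.HodgeRepro.Primitive

/-!
# Kida's Möbius table of the CM-subgroup poset (blind cell `pub-hodge-repro`, seat p2)

Kida, *Counting formulas for CM-types*, Moscow J. Comb. Number Theory 8 (2019) 343–359 (held,
`paper:doi-10-2140-moscow-2019-8-343`): for a finite group `G` with a central involution `ρ`, the CM
subgroups are `ℋ = {H ≤ G : ρ ∉ H}` ((1-1), p. 343), and the Möbius function on the poset `ℋ` is defined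
inductively by `μ(H₁, H₁) = 1`, `μ(H₁, H₂) = −Σ_{H₁ ≤ H < H₂} μ(H₁, H)` ((1-5), p. 344).  The counting
formulas (Thm 2.4, Prop 3.1, Thm 4.1) are sums of `μ`-values against powers of `2`; Example 6.3 (p. 352)
tabulates `μ` for the dihedral group `D_{2p}` (`p = 3`: our `D6`).

Here: subgroups as finsets (`IsSubgroupSet`, decidable), the CM subgroups `cmSubgroupSets c`, and a
computable `moebius` (fuel recursion on the cardinality, so that kernel `decide` evaluates the table),
with its defining recursion proved for the Kida poset.
-/

set_option autoImplicit false

open Finset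

namespace HodgeRepro

variable {G : Type*} [Group G] [DecidableEq G] [Fintype G]

/-- A finset closed under multiplication and containing `1` (a subgroup, `G` being finite). -/
def IsSubgroupSet (H : Finset G) : Prop := (1 : G) ∈ H ∧ ∀ a ∈ H, ∀ b ∈ H, a * b ∈ H

/-- `IsSubgroupSet H` is decidable for a finite group. -/
instance (H : Finset G) : Decidable (IsSubgroupSet H) := by unfold IsSubgroupSet; infer_instance

/-- Kida's CM subgroups `ℋ = {H ≤ G : c ∉ H}`, as finsets. -/
def cmSubgroupSets (c : G) : Finset (Finset G) :=
  univ.filter fun H => IsSubgroupSet H ∧ c ∉ H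

/-- Membership in `cmSubgroupSets c`: a subgroup-finset not containing `c`. -/
theorem mem_cmSubgroupSets (c : G) (H : Finset G) :
    H ∈ cmSubgroupSets c ↔ IsSubgroupSet H ∧ c ∉ H := by
  simp [cmSubgroupSets]

/-- The Möbius function of the poset `P` (finsets ordered by inclusion), with fuel. -/
def moebiusFuel (P : Finset (Finset G)) : ℕ → Finset G → Finset G → ℤ
  | 0, H, K => if H = K then 1 else 0
  | n + 1, H, K =>
      if H = K then 1
      else if H ⊆ K then -(∑ L ∈ P.filter (fun L => H ⊆ L ∧ L ⊂ K), moebiusFuel P n H L)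
      else 0

/-- Kida's Möbius function `μ(H, K)` on the poset `P` (fuel `|K|`, enough for every chain). -/
def moebius (P : Finset (Finset G)) (H K : Finset G) : ℤ := moebiusFuel P K.card H K

omit [Group G] [Fintype G] in
/-- The fuel is irrelevant once it is at least `|K| − |H|`. -/
theorem moebiusFuel_eq_of_le (P : Finset (Finset G)) :
    ∀ (n m : ℕ) (H K : Finset G), K.card - H.card ≤ n → K.card - H.card ≤ m →
      moebiusFuel P n H K = moebiusFuel P m H K := by
  intro n
  induction n with
  | zero =>
    intro m H K hn _
    cases m with
    | zero => rfl
    | succ m =>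
      by_cases hHK : H = K
      · simp [moebiusFuel, hHK]
      · by_cases hsub : H ⊆ K
        · exact absurd (eq_of_subset_of_card_le hsub (by omega)) hHK
        · simp [moebiusFuel, hHK, hsub]
  | succ n ih =>
    intro m H K hn hm
    cases m with
    | zero =>
      by_cases hHK : H = K
      · simp [moebiusFuel, hHK]
      · by_cases hsub : H ⊆ K
        · exact absurd (eq_of_subset_of_card_le hsub (by omega)) hHK
        · simp [moebiusFuel, hHK, hsub]
    | succ m =>
      by_cases hHK : H = K
      · simp [moebiusFuel, hHK]
      · by_cases hsub : H ⊆ K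
        · simp only [moebiusFuel, if_neg hHK, if_pos hsub]
          congr 1
          refine sum_congr rfl fun L hL => ?_
          rw [mem_filter] at hL
          have h1 := card_lt_card hL.2.2
          have h2 := card_le_card hL.2.1
          exact ih m H L (by omega) (by omega)
        · simp [moebiusFuel, hHK, hsub]

omit [Group G] [Fintype G] in
/-- Kida's recursion (1-5): `μ(H, H) = 1`. -/
theorem moebius_self (P : Finset (Finset G)) (H : Finset G) : moebius P H H = 1 := by
  unfold moebius
  cases h : H.card <;> simp [moebiusFuel]

omit [Group G] [Fintype G] in
/-- Kida's recursion (1-5): `μ(H, K) = −Σ_{H ≤ L < K} μ(H, L)` for `H ⊂ K`. -/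
theorem moebius_of_ssubset (P : Finset (Finset G)) {H K : Finset G} (hHK : H ⊂ K) :
    moebius P H K = -(∑ L ∈ P.filter (fun L => H ⊆ L ∧ L ⊂ K), moebius P H L) := by
  unfold moebius
  have hc : 0 < K.card := lt_of_le_of_lt (Nat.zero_le _) (card_lt_card hHK)
  obtain ⟨n, hn⟩ : ∃ n, K.card = n + 1 := ⟨K.card - 1, by omega⟩
  rw [hn]
  simp only [moebiusFuel, if_neg hHK.ne, if_pos hHK.1]
  congr 1
  refine sum_congr rfl fun L hL => ?_
  rw [mem_filter] at hL
  have h1 := card_lt_card hL.2.2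
  have h2 := card_le_card hL.2.1
  exact moebiusFuel_eq_of_le P n L.card H L (by omega) (by omega)

omit [Group G] [Fintype G] in
/-- The Möbius function vanishes off the order relation: `μ(H, K) = 0` unless `H ⊆ K`. -/
theorem moebius_of_not_subset (P : Finset (Finset G)) {H K : Finset G} (h : ¬ H ⊆ K) :
    moebius P H K = 0 := by
  have hHK : ¬ H = K := fun hHK => h (hHK ▸ Finset.Subset.refl _)
  unfold moebius
  cases K.card <;> simp [moebiusFuel, h, hHK]

/-! ### Tables for the census groups (kernel `decide`) -/

/-- The Möbius table of `(G, c)`: the triples `(H, K, μ(H, K))` over the CM subgroups. -/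
def moebiusTable (c : G) : Finset (Finset G × Finset G × ℤ) :=
  ((cmSubgroupSets c) ×ˢ (cmSubgroupSets c)).image fun p => (p.1, p.2, moebius (cmSubgroupSets c) p.1 p.2)

/-- Number of CM subgroups. -/
def cmSubgroupCount (c : G) : ℕ := (cmSubgroupSets c).card

/-- Kida's Prop. 3.1 right-hand side for `H = 1`: `Σ_{N ∈ ℋ} μ(1, N) 2^{[G : N]/2}`. -/
def kidaSimpleCount (c : G) : ℤ :=
  ∑ N ∈ cmSubgroupSets c, moebius (cmSubgroupSets c) {1} N * 2 ^ (Fintype.card G / N.card / 2)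

end HodgeRepro
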